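import Summits.PneNP.PneNP.Theorems.SymmetryBudgetWindowBarrierEntropyGameComplete
import Summits.PneNP.PneNP.Theorems.SymmetryBudgetWindowBarrierEntropyGameSizeTypes

/-!
# Completeness of the entropy game, VI: the size bound and the equivalences
(dichotomy `WindowBarrier` stmt-PneNP-2145 / `NoHiddenOrder` stmt-PneNP-14781, route `PneNP/SymmetryBudget`)

* `CosetGame.card_node_le` / **`CosetGame.card_node_rounds_le`**: the identification circuit of
  `…EntropyGameComplete.lean` has at most `2^{(10K+29)(n+1)}` gates (`|Ty| ≤ 2^{2n}2^{Kn}`, `|Cos A| ≤ 2^n 2^{Kn}`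
  of `…EntropyGameSizeTypes.lean`; thirteen gate families over rounds × positions).
* **`CosetGame.entropyGame_of_symIndistinguishable`** (COMPLETENESS): `∀ K ∃ c`, if no `Sym(Fin n)`-symmetric
  `tcBasis`-circuit with `≤ 2^{c(n+1)}` gates separates the adjacency matrices of `G` and `H` then
  `EntropyGame K G H`.  With the soundness theorem `CosetGame.eval_eq_of_entropyGame` this is an exact
  characterisation of indistinguishability by symmetric threshold circuits of size `2^{O(n)}`.
* **`CosetGame.entropyGames_of_hardToIdentify`**: HardToIdentify (the open core `stub_hardToIdentify` of
  stmt-PneNP-2145) implies entropy-`K` games on non-isomorphic pairs for every `K`, infinitely often —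
  the converse of `hardToIdentify_of_entropyGames`; hence **`hardToIdentify_iff_entropyGames`** and
  **`coreFooling_iff_hardToIdentify`**: the two "open cores" of the crux coincide, and both are the purely
  group-combinatorial statement "for every `K`, infinitely often, two non-isomorphic graphs admit an
  entropy-`K` game".
-/

-- `Summit.PneNP.PneNP.…` duplicates `PneNP` BY DESIGN (single-problem summit).
set_option linter.dupNamespace false

namespace Summit.PneNP.PneNP.Theorems

open Finset Filter Literature.Computability.Complexity Literature.ModelTheory.FiniteModelTheory
open scoped Classical

namespace CosetGame

variable {n K : ℕ}

noncomputable section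

open Node

/-! ### Counting gates -/

/-- Pairs of positions of a common type. -/
abbrev Pos₂ (n K : ℕ) : Type := Σ A : Ty n K, Cos A × Cos A

/-- **Gates are at most `13 · (T+1) · (|Pos₂|+1) · (|Pos|+1) · (n²+1)`.** -/
theorem card_node_le (T : ℕ) :
    Fintype.card (Node n K T) ≤
      13 * ((T + 1) * (Fintype.card (Pos₂ n K) + 1) * (Fintype.card (Pos n K) + 1) * (n * n + 1)) := by
  let S := Fin 3 ⊕ (Fin n × Fin n) ⊕ (Fin (T + 1) × Pos₂ n K) ⊕ (Fin 4 × Fin T × Pos₂ n K × Pos n K) ⊕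
    (Fin 4 × Pos₂ n K × (Fin n × Fin n))
  let ψ : S → Node n K T := fun s =>
    match s with
    | .inl c => if (c : ℕ) = 0 then tt else if (c : ℕ) = 1 then ff else out
    | .inr (.inl ⟨u, v⟩) => ex u v
    | .inr (.inr (.inl ⟨r, ⟨A, P, Q⟩⟩)) => rel r A P Q
    | .inr (.inr (.inr (.inl ⟨c, r, ⟨A, P, Q⟩, BD⟩))) =>
        if (c : ℕ) = 0 then bge r A P Q BD else if (c : ℕ) = 1 then bgt r A P Q BD else
        if (c : ℕ) = 2 then nbgt r A P Q BD else beq r A P Q BD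
    | .inr (.inr (.inr (.inr ⟨c, ⟨A, P, Q⟩, q⟩))) =>
        if (c : ℕ) = 0 then pge A P Q q else if (c : ℕ) = 1 then pgt A P Q q else
        if (c : ℕ) = 2 then npgt A P Q q else peq A P Q q
  have hψ : Function.Surjective ψ := by
    intro l
    cases l with
    | tt => exact ⟨.inl 0, rfl⟩
    | ff => exact ⟨.inl 1, rfl⟩
    | out => exact ⟨.inl 2, rfl⟩
    | ex u v => exact ⟨.inr (.inl ⟨u, v⟩), rfl⟩
    | rel r A P Q => exact ⟨.inr (.inr (.inl ⟨r, ⟨A, P, Q⟩⟩)), rfl⟩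
    | bge r A P Q BD => exact ⟨.inr (.inr (.inr (.inl ⟨0, r, ⟨A, P, Q⟩, BD⟩))), rfl⟩
    | bgt r A P Q BD => exact ⟨.inr (.inr (.inr (.inl ⟨1, r, ⟨A, P, Q⟩, BD⟩))), rfl⟩
    | nbgt r A P Q BD => exact ⟨.inr (.inr (.inr (.inl ⟨2, r, ⟨A, P, Q⟩, BD⟩))), rfl⟩
    | beq r A P Q BD => exact ⟨.inr (.inr (.inr (.inl ⟨3, r, ⟨A, P, Q⟩, BD⟩))), rfl⟩
    | pge A P Q q => exact ⟨.inr (.inr (.inr (.inr ⟨0, ⟨A, P, Q⟩, q⟩))), rfl⟩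
    | pgt A P Q q => exact ⟨.inr (.inr (.inr (.inr ⟨1, ⟨A, P, Q⟩, q⟩))), rfl⟩
    | npgt A P Q q => exact ⟨.inr (.inr (.inr (.inr ⟨2, ⟨A, P, Q⟩, q⟩))), rfl⟩
    | peq A P Q q => exact ⟨.inr (.inr (.inr (.inr ⟨3, ⟨A, P, Q⟩, q⟩))), rfl⟩
  have hcard := Fintype.card_le_of_surjective ψ hψ
  have hS : Fintype.card S = 3 + (n * n + ((T + 1) * Fintype.card (Pos₂ n K) +
      (4 * (T * (Fintype.card (Pos₂ n K) * Fintype.card (Pos n K))) + 4 * (Fintype.card (Pos₂ n K) * (n * n))))) := by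
    simp only [S, Fintype.card_sum, Fintype.card_prod, Fintype.card_fin]
  rw [hS] at hcard
  set N₁ := Fintype.card (Pos n K)
  set N₂ := Fintype.card (Pos₂ n K)
  set X := (T + 1) * (N₂ + 1) * (N₁ + 1) * (n * n + 1) with hX
  have le4 : ∀ {a b c d a' b' c' d' : ℕ}, a ≤ a' → b ≤ b' → c ≤ c' → d ≤ d' → a * b * c * d ≤ a' * b' * c' * d' :=
    fun h1 h2 h3 h4 => Nat.mul_le_mul (Nat.mul_le_mul (Nat.mul_le_mul h1 h2) h3) h4
  have b0 : 1 ≤ X := by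
    rw [hX]
    calc 1 = 1 * 1 * 1 * 1 := by ring
      _ ≤ _ := le4 (by omega) (by omega) (by omega) (by omega)
  have b1 : n * n ≤ X := by
    rw [hX]
    calc n * n = 1 * 1 * 1 * (n * n) := by ring
      _ ≤ _ := le4 (by omega) (by omega) (by omega) (by omega)
  have b2 : (T + 1) * N₂ ≤ X := by
    rw [hX]
    calc (T + 1) * N₂ = (T + 1) * N₂ * 1 * 1 := by ring
      _ ≤ _ := le4 le_rfl (by omega) (by omega) (by omega)
  have b3 : T * (N₂ * N₁) ≤ X := by
    rw [hX]
    calc T * (N₂ * N₁) = T * N₂ * N₁ * 1 := by ring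
      _ ≤ _ := le4 (by omega) (by omega) (by omega) (by omega)
  have b4 : N₂ * (n * n) ≤ X := by
    rw [hX]
    calc N₂ * (n * n) = 1 * N₂ * 1 * (n * n) := by ring
      _ ≤ _ := le4 (by omega) (by omega) (by omega) (by omega)
  omega

/-- `x + 1 ≤ 2^(p+1)` when `x ≤ 2^p`. -/
theorem succ_le_two_pow {x p : ℕ} (h : x ≤ 2 ^ p) : x + 1 ≤ 2 ^ (p + 1) := by
  rw [pow_succ]; have := Nat.one_le_two_pow (n := p); omega

/-- `n² + 1 ≤ 2^{2n}`. -/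
theorem sq_succ_le_two_pow (n : ℕ) : n * n + 1 ≤ 2 ^ (2 * n) := by
  rcases Nat.eq_zero_or_pos n with rfl | hn
  · simp
  · have h1 : n ≤ 2 ^ n := Nat.lt_two_pow_self.le
    have h2 : n * n ≤ 2 ^ n * 2 ^ n := Nat.mul_le_mul h1 h1
    have h3 : 2 ^ n * 2 ^ n = 2 ^ (2 * n) := by rw [two_mul, pow_add]
    have h4 : 2 ≤ 2 ^ n := by
      calc (2 : ℕ) = 2 ^ 1 := by norm_num
        _ ≤ 2 ^ n := Nat.pow_le_pow_right Nat.two_pos hn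
    -- `n² < 4^n` strictly, so `n² + 1 ≤ 4^n`
    have h5 : n * n < 2 ^ n * 2 ^ n := by
      rcases Nat.lt_or_ge n (2 ^ n) with hlt | hge
      · calc n * n ≤ n * 2 ^ n := Nat.mul_le_mul_left n h1
          _ < 2 ^ n * 2 ^ n := Nat.mul_lt_mul_of_pos_right hlt (by omega)
      · exact absurd hge (not_le.2 Nat.lt_two_pow_self)
    omega

/-- `|Pos n K| ≤ |Ty| · max |Cos|` and `|Pos₂ n K| ≤ |Ty| · (max |Cos|)²`, in powers of two: with
`L = (K+2) n`, `|Pos| ≤ 2^{2L}` and `|Pos₂| ≤ 2^{3L}`. -/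
theorem card_pos_le : Fintype.card (Pos n K) ≤ 2 ^ (2 * ((K + 2) * n)) := by
  have hM : ∀ A : Ty n K, Fintype.card (Cos A) ≤ 2 ^ ((K + 2) * n) := fun A =>
    (card_cos_le A).trans (by
      rw [← pow_add]; exact Nat.pow_le_pow_right Nat.two_pos (by nlinarith))
  have hY : Fintype.card (Ty n K) ≤ 2 ^ ((K + 2) * n) :=
    card_ty_le.trans (by rw [← pow_add]; exact Nat.pow_le_pow_right Nat.two_pos (by nlinarith))
  rw [Fintype.card_sigma]
  calc ∑ A, Fintype.card (Cos A) ≤ ∑ _A : Ty n K, 2 ^ ((K + 2) * n) := Finset.sum_le_sum fun A _ => hM A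
    _ = Fintype.card (Ty n K) * 2 ^ ((K + 2) * n) := by rw [Finset.sum_const, smul_eq_mul, Finset.card_univ]
    _ ≤ 2 ^ ((K + 2) * n) * 2 ^ ((K + 2) * n) := Nat.mul_le_mul_right _ hY
    _ = 2 ^ (2 * ((K + 2) * n)) := by rw [two_mul, pow_add]

/-- See `card_pos_le`. -/
theorem card_pos₂_le : Fintype.card (Pos₂ n K) ≤ 2 ^ (3 * ((K + 2) * n)) := by
  have hM : ∀ A : Ty n K, Fintype.card (Cos A) ≤ 2 ^ ((K + 2) * n) := fun A =>
    (card_cos_le A).trans (by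
      rw [← pow_add]; exact Nat.pow_le_pow_right Nat.two_pos (by nlinarith))
  have hY : Fintype.card (Ty n K) ≤ 2 ^ ((K + 2) * n) :=
    card_ty_le.trans (by rw [← pow_add]; exact Nat.pow_le_pow_right Nat.two_pos (by nlinarith))
  rw [Fintype.card_sigma]
  calc ∑ A, Fintype.card (Cos A × Cos A)
      ≤ ∑ _A : Ty n K, 2 ^ ((K + 2) * n) * 2 ^ ((K + 2) * n) :=
        Finset.sum_le_sum fun A _ => by rw [Fintype.card_prod]; exact Nat.mul_le_mul (hM A) (hM A)
    _ = Fintype.card (Ty n K) * (2 ^ ((K + 2) * n) * 2 ^ ((K + 2) * n)) := by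
        rw [Finset.sum_const, smul_eq_mul, Finset.card_univ]
    _ ≤ 2 ^ ((K + 2) * n) * (2 ^ ((K + 2) * n) * 2 ^ ((K + 2) * n)) := Nat.mul_le_mul_right _ hY
    _ = 2 ^ (3 * ((K + 2) * n)) := by ring

/-- The number of rounds: `|St n K| = 4 |Pos₂ n K| ≤ 2^{3L+2}`. -/
theorem rounds_le : rounds n K ≤ 2 ^ (3 * ((K + 2) * n) + 2) := by
  have h : rounds n K = 4 * Fintype.card (Pos₂ n K) := by
    rw [rounds, Fintype.card_sigma, Fintype.card_sigma, Finset.mul_sum]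
    refine Finset.sum_congr rfl fun A _ => ?_
    simp only [Fintype.card_prod, Fintype.card_bool]
    ring
  rw [h, pow_add]
  have := card_pos₂_le (n := n) (K := K)
  have h4 : (2 : ℕ) ^ 2 = 4 := by norm_num
  rw [h4]
  omega

/-- **The identification circuit has at most `2^{(10K+29)(n+1)}` gates.** -/
theorem card_node_rounds_le (n K : ℕ) :
    Fintype.card (Node n K (rounds n K)) ≤ 2 ^ ((10 * K + 29) * (n + 1)) := by
  have mul_le_two_pow : ∀ {a b p q : ℕ}, a ≤ 2 ^ p → b ≤ 2 ^ q → a * b ≤ 2 ^ (p + q) :=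
    fun ha hb => by rw [pow_add]; exact Nat.mul_le_mul ha hb
  set L := (K + 2) * n with hL
  have hT : rounds n K + 1 ≤ 2 ^ (3 * L + 3) := succ_le_two_pow rounds_le
  have hN₂ : Fintype.card (Pos₂ n K) + 1 ≤ 2 ^ (3 * L + 1) := succ_le_two_pow card_pos₂_le
  have hN₁ : Fintype.card (Pos n K) + 1 ≤ 2 ^ (2 * L + 1) := succ_le_two_pow card_pos_le
  have hn : n * n + 1 ≤ 2 ^ (2 * n) := sq_succ_le_two_pow n
  have hX := mul_le_two_pow (mul_le_two_pow (mul_le_two_pow hT hN₂) hN₁) hn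
  have h13 : (13 : ℕ) ≤ 2 ^ 4 := by norm_num
  have h := (card_node_le (n := n) (K := K) (rounds n K)).trans (mul_le_two_pow h13 hX)
  refine h.trans (Nat.pow_le_pow_right Nat.two_pos ?_)
  rw [hL]
  nlinarith

/-! ### Completeness -/

/-- **COMPLETENESS of the entropy game.**  For every `K` there is `c` such that: if no
`Sym(Fin n)`-symmetric `tcBasis`-circuit with at most `2^{c(n+1)}` gates separates the adjacency matrices
of `G` and `H`, then `G` and `H` admit an entropy-`K` game.  (Converse of `eval_eq_of_entropyGame` up
to the constants.) -/
theorem entropyGame_of_symIndistinguishable (K : ℕ) : ∃ c : ℕ, ∀ (n : ℕ) (G H : SimpleGraph (Fin n))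
    [DecidableRel G.Adj] [DecidableRel H.Adj],
    (∀ C : Circuit (Fin n × Fin n), C.IsOver tcBasis → C.IsSymmetricUnder Set.univ →
      C.size ≤ 2 ^ (c * (n + 1)) → C.eval (adjInput G) = C.eval (adjInput H)) →
    Nonempty (EntropyGame K G H) := by
  refine ⟨10 * K + 29, fun n G H _ _ h => ?_⟩
  refine entropyGame_of_indistinguishable K G H fun C hB hsym hsize => ?_
  have key := h C hB hsym (hsize.trans (card_node_rounds_le n K))
  -- `adjInput` does not depend on the decidability instances
  convert key using 2 <;> (funext q; simp [adjInput])

/-! ### HardToIdentify ⟺ entropy games ⟺ (★) CoreFooling -/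

/-- **HardToIdentify gives entropy games**: if for every rate some graph is not identified by a
symmetric circuit of size `2^{cn}`, infinitely often, then for every `K`, infinitely often two
NON-ISOMORPHIC graphs admit an entropy-`K` game — because the identification circuit of `H`
(`exists_identifying_circuit`, size `≤ 2^{(10K+29)(n+1)} ≤ 2^{(20K+58) n}` for `n ≥ 1`) accepts exactly the
entropy-`K` class of `H`, which must then be larger than the isomorphism class. -/
theorem entropyGames_of_hardToIdentify
    (hHTI : ∀ c : ℕ, ∃ᶠ h in atTop, ∃ H : SimpleGraph (Fin h),
      ¬ HasSymCircuit tcBasis Set.univ (2 ^ (c * h))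
        (fun x : Fin h × Fin h → Bool =>
          decide (Nonempty ((SimpleGraph.fromRel fun u v => x (u, v) = true) ≃g H)))) :
    ∀ K : ℕ, ∃ᶠ n in atTop, ∃ G H : SimpleGraph (Fin n), ¬ Nonempty (G ≃g H) ∧ Nonempty (EntropyGame K G H) := by
  intro K
  have hfreq := (hHTI (2 * ((10 * K + 29)))).and_eventually (eventually_ge_atTop 1)
  refine hfreq.mono ?_
  rintro n ⟨⟨H, hH⟩, hn⟩
  obtain ⟨C, hB, hsym, hsize, hC⟩ := exists_identifying_circuit K H
  have hsz : C.size ≤ 2 ^ (2 * (10 * K + 29) * n) := by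
    rw [hsize]
    refine (card_node_rounds_le n K).trans (Nat.pow_le_pow_right Nat.two_pos ?_)
    nlinarith
  -- `C` does not compute the isomorphism indicator, so it accepts a non-isomorphic graph
  by_contra hno
  refine hH ⟨C, hB, hsz, hsym, fun x => ?_⟩
  by_cases hx : C.eval x = true
  · rw [hx]
    symm
    rw [decide_eq_true_iff]
    by_contra hiso
    exact hno ⟨_, H, hiso, (hC x).1 hx⟩
  · have hx' : C.eval x = false := by simpa using hx
    rw [hx']
    symm
    rw [decide_eq_false_iff_not]
    rintro ⟨e⟩
    exact hx ((hC x).2 ⟨EntropyGame.ofIso K e⟩)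

/-- **HardToIdentify ⟺ entropy games** (`entropyGames_of_hardToIdentify` and the landed
`hardToIdentify_of_entropyGames`): the open core of crux stmt-PneNP-2145 is exactly the
group-combinatorial statement "for every `K`, infinitely often, two non-isomorphic graphs admit an
entropy-`K` game". -/
theorem hardToIdentify_iff_entropyGames :
    (∀ c : ℕ, ∃ᶠ h in atTop, ∃ H : SimpleGraph (Fin h),
      ¬ HasSymCircuit tcBasis Set.univ (2 ^ (c * h))
        (fun x : Fin h × Fin h → Bool =>
          decide (Nonempty ((SimpleGraph.fromRel fun u v => x (u, v) = true) ≃g H)))) ↔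
    ∀ K : ℕ, ∃ᶠ n in atTop, ∃ G H : SimpleGraph (Fin n), ¬ Nonempty (G ≃g H) ∧ Nonempty (EntropyGame K G H) :=
  ⟨entropyGames_of_hardToIdentify, hardToIdentify_of_entropyGames⟩

/-- **(★) CoreFooling ⟺ HardToIdentify** (new direction: HTI ⟹ (★), through the games): the two open
cores of the crux coincide. -/
theorem coreFooling_iff_hardToIdentify :
    (∀ d : ℕ, ∃ᶠ g in atTop, ∃ G₁ G₂ : SimpleGraph (Fin g), ¬ Nonempty (G₁ ≃g G₂) ∧
      ∀ C : Circuit (Fin g × Fin g), C.IsOver tcBasis → C.size ≤ 2 ^ (d * g) →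
        C.IsSymmetricUnder Set.univ →
          C.eval (fun p : Fin g × Fin g => decide (G₁.Adj p.1 p.2)) =
            C.eval (fun p : Fin g × Fin g => decide (G₂.Adj p.1 p.2))) ↔
    (∀ c : ℕ, ∃ᶠ h in atTop, ∃ H : SimpleGraph (Fin h),
      ¬ HasSymCircuit tcBasis Set.univ (2 ^ (c * h))
        (fun x : Fin h × Fin h → Bool =>
          decide (Nonempty ((SimpleGraph.fromRel fun u v => x (u, v) = true) ≃g H)))) :=
  ⟨hardToIdentify_of_coreFooling, fun h => coreFooling_of_entropyGames (entropyGames_of_hardToIdentify h)⟩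

end

end CosetGame

end Summit.PneNP.PneNP.Theorems
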